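import Summits.BirchSwinnertonDyer.BirchSwinnertonDyer.Theorems.GenusKolyvaginAtTwoPowDvdShaCardAtTwoRTLocalKernelOneBit
import Summits.BirchSwinnertonDyer.BirchSwinnertonDyer.Theorems.GenusKolyvaginAtTwoPowDvdShaCardAtTwoRTLocalKernelQuadratic
import Literature.NumberTheory.EllipticCurves.ShaRestriction
import Mathlib.FieldTheory.PrimitiveElement
import HarnessLib

/-!
# Route `GenusKolyvaginAtTwo`, LINE 18 (L_T `PowDvdShaCardAtTwoRT`, stmt-BirchSwinnertonDyer-23242): GENUS CLASSES —
# the classes `τ ↦ P` of anti-invariant points `P ∈ E(L)^−` in `H¹(F, E)`, their vanishing over `L`, and their relations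

Seat `bsd-line-gk2-p2` g17 (cell `bsd-f1-sign2`), `--supports stmt-BirchSwinnertonDyer-23242` (helper; closes nothing).
THEOREMS ONLY (no definition, no named fact, no `sorry`); BSD is not proved by any of this.

WHY.  The companion file `…RTGenusLadder` (p696983) shows that the registered cross-side count J of LINE 18 v5 is contradicted by any
family of `𝔽₂`-independent order-`2` classes of `H¹(ℚ, W)` and `H¹(ℚ, Wd)` DYING over `K`.  This file SUPPLIES such classes from
points, making the refuting row a Mordell–Weil-level predicate: for a quadratic extension `L/F` (char. `0`) with non-trivial
automorphism `τ` and points `Q_i ∈ E(L)` with `τ Q_i = −Q_i` (twist points `ψ(E^{(d)}(F))`, rational `2`-torsion) there are classes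
`x_i ∈ ker(H¹(F, E) → H¹(L, E_L))` with `Σ c_i x_i = 0 ⟺ Σ c_i Q_i ∈ (τ − 1)E(L)` — the isomorphism `H¹(Gal(L/F), E(L)) = E(L)^−/(τ−1)E(L)`
(Serre, *Local Fields* VIII.§4; Kramer 1981 §3/§5) read on explicit classes in the tree's continuous-cochain model.

* §1 (abstract, index two: `N ⊴ G` open with coset generator `σ`, `S = M^N`):
  `inflClass_eq_zero_iff_exists_smul_sub` — an inflated class vanishes iff its value at `σ` lies in `(σ−1)S`;
  `exists_cocyclesVanishingOn_apply_eq_ite` — the cocycle `g ↦ [g ∉ N]·P` of an anti-invariant `P ∈ S`;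
  `exists_inflClass_family_of_smul_eq_neg` — for anti-invariant `P_i ∈ S`: classes `x_i ∈ range(infl)` with
  `Σ c_i x_i = 0 ⟺ ∃ b ∈ S, Σ c_i P_i = σ b − b`;
  `inflClass_mem_resKer_of_range_le` — inflated classes die under restriction along `θ : H → G` with `θ(H) ≤ N`.
* §2 (a Weierstrass curve `W` over a field `F` of characteristic `0`, `L/F` quadratic, `τ ∈ Aut(L/F)`, `τ ≠ 1`):
  `algHom_comp_eq_comp_of_not_mem_galRange` — a `σ ∈ Γ_F` outside `Γ_L` acts on the copy of `L` in `F̄` through `τ`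
  (`AlgHom.card = [L:F] = 2`); **`exists_genusClasses`** — for `Q : ι → E(L)` with `τ Q_i = −Q_i` there are `x_i ∈ H¹(F, E)` with
  `res_L x_i = 0` (`resBaseChange`), and `Σ c_i x_i = 0 ⟺ ∃ R ∈ E(L), Σ c_i Q_i = τR − R`; corollaries `two_smul_genusClass`
  (`2 x_i = 0`), `exists_genusPair_of_indep` (two `𝔽₂`-independent order-`2` kernel classes from two points independent modulo
  `(τ−1)E(L)` — the datum of `…RTGenusLadder.not_jointGenusCount_of_kerPairs`).

References: [SerreLocalFields1979] VIII.§4; [SerreGaloisCohomology1997] I.§2.4, I.§5.8; [Kramer1981] §3 (proof of Thm. 2), §5 Prop. 8.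
-/

set_option autoImplicit false
-- the Theorems namespace of this sub repeats the summit name by design (D-0017 nested layout)
set_option linter.dupNamespace false

noncomputable section

open scoped Classical

namespace Summit.BirchSwinnertonDyer.BirchSwinnertonDyer.Theorems.GenusExact.PlusDescent

open Literature.NumberTheory.EllipticCurves Literature.NumberTheory.GaloisRepresentations

universe u

/-! ## §1 Index two: inflated classes of anti-invariants and their relations -/

section IndexTwo

variable {G : Type u} [Group G] [TopologicalSpace G] [IsTopologicalGroup G]
variable {M : Type u} [AddCommGroup M] [DistribMulAction G M] [TopologicalSpace M]
  [DiscreteTopology M]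
variable {N : Subgroup G} {σ : G} {S : AddSubgroup M}

/-- **`H¹(G/N, S) = S⁻/(σ−1)S` on classes (index two)**: an inflated class `[f]` vanishes in `H¹_cont(G, M)` iff `f(σ) = σ b − b`
for some `b ∈ S = M^N` (`⇐`: `inflClass_eq_zero_of_apply_eq_smul_sub`; `⇒`: a bounding `m` with `f g = g m − m` is `N`-invariant
because `f` vanishes on `N`). [cite: SerreGaloisCohomology1997, I.§2.4 and I.§5.8] -/
theorem inflClass_eq_zero_iff_exists_smul_sub [N.Normal] (hN : IsOpen (N : Set G))
    (hσ : ∀ b : G, Xor (b * σ ∈ N) (b ∈ N)) (hS : ∀ m : M, m ∈ S ↔ ∀ n ∈ N, n • m = m)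
    (f : cocyclesVanishingOn M N) :
    inflClass M N hN f = 0 ↔ ∃ b ∈ S, f.1 σ = σ • b - b := by
  refine ⟨fun h ↦ ?_, fun ⟨b, hb, hfb⟩ ↦ inflClass_eq_zero_of_apply_eq_smul_sub hN hσ hS f hb hfb⟩
  rw [inflClass_apply, oneCocycleClass_eq_zero_iff] at h
  obtain ⟨m, hm⟩ := h
  have hmN : ∀ n ∈ N, n • m = m := fun n hn ↦ by
    have h := hm n
    rw [discreteTopRep_ρ_apply, toContOneCocycle_apply, cocyclesVanishingOn.apply_of_mem f hn, eq_comm,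
      sub_eq_zero] at h
    exact h
  refine ⟨m, (hS m).mpr hmN, ?_⟩
  have h := hm σ
  rwa [discreteTopRep_ρ_apply, toContOneCocycle_apply] at h

omit [TopologicalSpace G] [IsTopologicalGroup G] [TopologicalSpace M] [DiscreteTopology M] in
/-- **The genus cocycle `g ↦ [g ∉ N]·P`** of an anti-invariant `P ∈ S = M^N` (`σP = −P`): a crossed homomorphism `G → M`
vanishing on `N` (on `N σ × N σ` the identity reads `0 = P + nσP = P − P`). [cite: SerreLocalFields1979, VIII.§4] -/
theorem exists_cocyclesVanishingOn_apply_eq_ite [N.Normal] (hσ : ∀ b : G, Xor (b * σ ∈ N) (b ∈ N))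
    (hS : ∀ m : M, m ∈ S ↔ ∀ n ∈ N, n • m = m) {P : M} (hP : P ∈ S) (hσP : σ • P = -P) :
    ∃ a : cocyclesVanishingOn M N, ∀ g : G, a.1 g = if g ∈ N then 0 else P := by
  have hPN : ∀ n ∈ N, n • P = P := (hS P).mp hP
  refine ⟨⟨fun g ↦ if g ∈ N then 0 else P, fun g h ↦ ?_, fun n hn ↦ by simp only [hn, if_true]⟩, fun g ↦ rfl⟩
  by_cases hg : g ∈ N <;> by_cases hh : h ∈ N
  · simp only [hg, hh, N.mul_mem hg hh, if_true, smul_zero, add_zero]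
  · have hgh : g * h ∉ N := fun hgh ↦ hh (by simpa using N.mul_mem (N.inv_mem hg) hgh)
    simp only [hgh, hg, hh, if_true, if_false, hPN g hg, zero_add]
  · have hgh : g * h ∉ N := fun hgh ↦ hg (by simpa using N.mul_mem hgh (N.inv_mem hh))
    simp only [hgh, hg, hh, if_true, if_false, smul_zero, add_zero]
  · -- both off `N`: `g h ∈ N` and `P + g • P = P - P = 0`
    obtain ⟨n', hn', rfl⟩ := exists_eq_mul_of_not_mem hσ hh
    obtain ⟨n, hn, rfl⟩ := exists_eq_mul_of_not_mem hσ hg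
    have hgn' : n * σ * n' ∉ N := fun h1 ↦ hg (by simpa using N.mul_mem h1 (N.inv_mem hn'))
    have hgh : n * σ * (n' * σ) ∈ N := by
      rw [← mul_assoc]
      exact (hσ (n * σ * n')).elim (fun h1 ↦ h1.1) fun h2 ↦ (hgn' h2.1).elim
    simp only [hgh, hg, hh, if_true, if_false, mul_smul, hσP, smul_neg, hPN n hn, add_neg_cancel]

/-- **Inflated classes of anti-invariants and their relations** (index two).  For anti-invariant `P_i ∈ S = M^N` (`σ P_i = −P_i`)
there are classes `x_i ∈ range(infl) ⊆ H¹_cont(G, M)` — the classes of the genus cocycles `g ↦ [g ∉ N]·P_i` — such that for every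
`c : ι → ℤ`: `Σ c_i x_i = 0 ⟺ Σ c_i P_i = σ b − b` for some `b ∈ S`.  (The assignment `P ↦ [g ↦ [g ∉ N]·P]` is additive, and
`H¹(G/N, S) = S⁻/(σ−1)S`.) [cite: SerreLocalFields1979, VIII.§4] [cite: Kramer1981, §3 (proof of Thm. 2)] -/
theorem exists_inflClass_family_of_smul_eq_neg [N.Normal] (hN : IsOpen (N : Set G))
    (hσ : ∀ b : G, Xor (b * σ ∈ N) (b ∈ N)) (hS : ∀ m : M, m ∈ S ↔ ∀ n ∈ N, n • m = m)
    {ι : Type*} [Fintype ι] (P : ι → M) (hP : ∀ i, P i ∈ S) (hσP : ∀ i, σ • P i = -P i) :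
    ∃ x : ι → discreteH1 G M, (∀ i, x i ∈ (inflClass M N hN).range) ∧
      ∀ c : ι → ℤ, ∑ i, c i • x i = 0 ↔ ∃ b ∈ S, ∑ i, c i • P i = σ • b - b := by
  choose a ha using fun i ↦ exists_cocyclesVanishingOn_apply_eq_ite hσ hS (hP i) (hσP i)
  have hσN : σ ∉ N := not_mem_of_xor_mul hσ
  refine ⟨fun i ↦ inflClass M N hN (a i), fun i ↦ ⟨a i, rfl⟩, fun c ↦ ?_⟩
  have hsum : ∑ i, c i • inflClass M N hN (a i) = inflClass M N hN (∑ i, c i • a i) := by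
    rw [map_sum]
    simp only [map_zsmul]
  have hval : (∑ i, c i • a i : cocyclesVanishingOn M N).1 σ = ∑ i, c i • P i := by
    rw [AddSubgroup.val_finsetSum, Finset.sum_apply]
    refine Finset.sum_congr rfl fun i _ ↦ ?_
    rw [AddSubgroup.coe_zsmul, Pi.smul_apply, ha i σ, if_neg hσN]
  rw [hsum, inflClass_eq_zero_iff_exists_smul_sub hN hσ hS, hval]

/-- **Inflated classes die under restriction to a subgroup inside `N`.**  For a compatible pair `(θ : H → G, ψ : M → M')` with
`θ(H) ≤ N`, every class inflated from a cocycle vanishing on `N` lies in the kernel of `H¹_cont(G, M) → H¹_cont(H, M')`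
(the pulled-back cocycle is identically `0`).  (`res ∘ inf = 0`.) [cite: SerreGaloisCohomology1997, I.§5.8] -/
theorem inflClass_mem_resKer_of_range_le {H : Type u} [Group H] [TopologicalSpace H] [IsTopologicalGroup H]
    {M' : Type u} [AddCommGroup M'] [DistribMulAction H M'] [TopologicalSpace M'] [DiscreteTopology M']
    (θ : H →ₜ* G) (ψ : M →+ M') (h : ∀ (x : H) (m : M), ψ (θ x • m) = x • ψ m)
    (hN : IsOpen (N : Set G)) (hθN : (θ : H →* G).range ≤ N) (f : cocyclesVanishingOn M N) :
    inflClass M N hN f ∈ resKer θ ψ h := by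
  rw [inflClass_apply, oneCocycleClass_mem_resKer_iff]
  refine ⟨0, fun x ↦ ?_⟩
  have hx : θ x ∈ N := hθN ⟨x, rfl⟩
  rw [toContOneCocycle_apply, cocyclesVanishingOn.apply_of_mem f hx, map_zero, smul_zero, sub_zero]

end IndexTwo

/-! ## §2 Genus classes of a quadratic extension `L/F` -/

section Field

open WeierstrassCurve IntermediateField Literature.Barriers.BirchSwinnertonDyer

variable {F : Type u} [Field F] [CharZero F] (W : WeierstrassCurve F) (L : Type u) [Field L] [Algebra F L]
  [FiniteDimensional F L]

/-- **Outside `Γ_L`, `Γ_F` acts on the copy of `L` in `F̄` through the non-trivial automorphism.**  For `[L : F] = 2` with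
non-trivial `τ ∈ Aut(L/F)`, the copy `j = e⁻¹ ∘ (L → L̄) : L → F̄` and `σ ∈ Γ_F ∖ galRange L`: `σ ∘ j = j ∘ τ` (the three `F`-embeddings
`j`, `σ ∘ j`, `j ∘ τ` of `L` into `F̄` cannot be pairwise distinct, `#(L →ₐ[F] F̄) = [L : F] = 2`; and `σ ∘ j ≠ j ≠ j ∘ τ`).
[cite: SerreGaloisCohomology1997, II.§1.1] -/
theorem algHom_comp_eq_comp_of_not_mem_galRange (h2 : Module.finrank F L = 2) (τ : L ≃ₐ[F] L) (hτ : τ ≠ 1)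
    {σ : Field.absoluteGaloisGroup F} (hσ : σ ∉ galRange (K := F) L) :
    ((show AlgebraicClosure F ≃ₐ[F] AlgebraicClosure F from σ) : AlgebraicClosure F →ₐ[F] AlgebraicClosure F).comp
        (((algEquivOfEmb L (closureEmb (K := F) L)).symm : AlgebraicClosure L →ₐ[F] AlgebraicClosure F).comp
          (IsScalarTower.toAlgHom F L (AlgebraicClosure L))) =
      (((algEquivOfEmb L (closureEmb (K := F) L)).symm : AlgebraicClosure L →ₐ[F] AlgebraicClosure F).comp
          (IsScalarTower.toAlgHom F L (AlgebraicClosure L))).comp (τ : L →ₐ[F] L) := by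
  haveI : Algebra.IsAlgebraic F L := Algebra.IsAlgebraic.of_finite F L
  set j : L →ₐ[F] AlgebraicClosure F :=
    (((algEquivOfEmb L (closureEmb (K := F) L)).symm : AlgebraicClosure L →ₐ[F] AlgebraicClosure F).comp
      (IsScalarTower.toAlgHom F L (AlgebraicClosure L))) with hj
  set σ' : AlgebraicClosure F →ₐ[F] AlgebraicClosure F :=
    ((show AlgebraicClosure F ≃ₐ[F] AlgebraicClosure F from σ) : AlgebraicClosure F →ₐ[F] AlgebraicClosure F) with hσ'
  -- `σ ∘ j ≠ j`: otherwise `σ` fixes `j(L)` pointwise, i.e. `σ ∈ galRange L`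
  have h1 : σ'.comp j ≠ j := by
    intro heq
    apply hσ
    rw [mem_galRange_iff_forall_apply_eq]
    intro x
    exact congrArg (fun φ : L →ₐ[F] AlgebraicClosure F ↦ φ x) heq
  -- `j ∘ τ ≠ j`: `τ ≠ 1` and `j` is injective
  have h3 : j.comp (τ : L →ₐ[F] L) ≠ j := by
    intro heq
    apply hτ
    ext x
    have hx := congrArg (fun φ : L →ₐ[F] AlgebraicClosure F ↦ φ x) heq
    simp only [AlgHom.comp_apply] at hx
    exact j.injective hx
  -- count: `#(L →ₐ[F] F̄) = 2`
  have hcard : Fintype.card (L →ₐ[F] AlgebraicClosure F) = 2 := by rw [AlgHom.card, h2]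
  by_contra hne
  have h3' : ({σ'.comp j, j.comp (τ : L →ₐ[F] L), j} : Finset (L →ₐ[F] AlgebraicClosure F)).card = 3 := by
    rw [Finset.card_insert_of_notMem, Finset.card_insert_of_notMem, Finset.card_singleton]
    · simpa only [Finset.mem_singleton] using h3
    · simp only [Finset.mem_insert, Finset.mem_singleton, not_or]
      exact ⟨hne, h1⟩
  have hle := Finset.card_le_univ ({σ'.comp j, j.comp (τ : L →ₐ[F] L), j} : Finset (L →ₐ[F] AlgebraicClosure F))
  rw [h3', hcard] at hle
  omega

/-- **GENUS CLASSES.**  Let `L/F` be quadratic (`F` of characteristic `0`) with non-trivial automorphism `τ`, `W/F` a Weierstrass curve and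
`Q_i ∈ E(L)` ANTI-invariant points (`τ Q_i = −Q_i`; e.g. twist points `ψ(E^{(d)}(F))`, rational `2`-torsion).  Then there are classes
`x_i ∈ H¹(F, E)` — the inflations of the cocycles `g ↦ [g ∉ Γ_L]·Q_i` of `Gal(L/F)` — with: (i) `res_L x_i = 0` in `H¹(L, E_L)`;
(ii) `2 x_i = 0`; (iii) for every `c : ι → ℤ`, `Σ c_i x_i = 0 ⟺ Σ c_i Q_i = τR − R` for some `R ∈ E(L)`.  (iii) is the isomorphism
`H¹(Gal(L/F), E(L)) = E(L)^−/(τ−1)E(L)` composed with the injectivity of inflation. [cite: SerreLocalFields1979, VIII.§4]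
[cite: SerreGaloisCohomology1997, I.§2.4 and I.§5.8] [cite: Kramer1981, §3 (proof of Thm. 2) and §5 Prop. 8] -/
theorem exists_genusClasses (h2 : Module.finrank F L = 2) (τ : L ≃ₐ[F] L) (hτ : τ ≠ 1)
    {ι : Type*} [Fintype ι] (Q : ι → (W.baseChange L).toAffine.Point)
    (hQ : ∀ i, WeierstrassCurve.Affine.Point.map (W' := W) (τ : L →ₐ[F] L) (Q i) = -Q i) :
    ∃ x : ι → W.galH1, (∀ i, resBaseChange W L (x i) = 0) ∧ (∀ i, 2 • x i = 0) ∧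
      ∀ c : ι → ℤ, ∑ i, c i • x i = 0 ↔
        ∃ R : (W.baseChange L).toAffine.Point,
          ∑ i, c i • Q i = WeierstrassCurve.Affine.Point.map (W' := W) (τ : L →ₐ[F] L) R - R := by
  haveI : Algebra.IsAlgebraic F L := Algebra.IsAlgebraic.of_finite F L
  haveI : IsGalois F (AlgebraicClosure F) := {}
  -- the copy `j : L → F̄` and its field range `F'`
  set e : AlgebraicClosure F ≃ₐ[F] AlgebraicClosure L := algEquivOfEmb L (closureEmb (K := F) L) with he
  set j : L →ₐ[F] AlgebraicClosure F :=
    ((e.symm : AlgebraicClosure L →ₐ[F] AlgebraicClosure F).comp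
      (IsScalarTower.toAlgHom F L (AlgebraicClosure L))) with hj
  set F' : IntermediateField F (AlgebraicClosure F) := j.fieldRange with hF'
  set N : Subgroup (Field.absoluteGaloisGroup F) := galRange (K := F) L with hNdef
  have hN : N = F'.fixingSubgroup := galRange_eq_fixingSubgroup_fieldRange L
  let eL : L ≃ₐ[F] F' := AlgHom.equivFieldRange j
  haveI : FiniteDimensional F F' := LinearEquiv.finiteDimensional eL.toLinearEquiv
  have hNopen : IsOpen (N : Set (Field.absoluteGaloisGroup F)) := by
    rw [hN]; exact IntermediateField.fixingSubgroup_isOpen F'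
  have hidx : N.index = 2 := by
    rw [hN]
    refine ((IntermediateField.finrank_eq_fixingSubgroup_index F').symm.trans ?_)
    rw [← eL.toLinearEquiv.finrank_eq, h2]
  haveI : N.Normal := Subgroup.normal_of_index_eq_two hidx
  haveI : N.FiniteIndex := ⟨by rw [hidx]; norm_num⟩
  obtain ⟨σ, hσ⟩ := Subgroup.index_eq_two_iff.mp hidx
  have hσN : σ ∉ N := not_mem_of_xor_mul hσ
  -- the invariants: `S = E(F') ≅ E(L)`
  set m : (W.baseChange F').toAffine.Point →+ geomPoints W :=
    WeierstrassCurve.Affine.Point.map (W' := W) (F'.val : F' →ₐ[F] AlgebraicClosure F) with hm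
  have hminj : Function.Injective m := WeierstrassCurve.Affine.Point.map_injective _
  set S : AddSubgroup (geomPoints W) := m.range with hSdef
  have hS : ∀ P : geomPoints W, P ∈ S ↔ ∀ n ∈ N, n • P = P := by
    intro P
    rw [hN]
    refine ⟨?_, mem_range_map_val_of_forall_smul_eq W F' P⟩
    rintro ⟨Q', rfl⟩ τ' hτ'
    exact smul_eq_of_map_val_eq W F' Q' _ rfl hτ'
  let m₁ : (W.baseChange L).toAffine.Point →+ (W.baseChange F').toAffine.Point :=
    WeierstrassCurve.Affine.Point.map (W' := W) (eL : L →ₐ[F] F')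
  have hm₁ : Function.Bijective m₁ := by
    refine ⟨WeierstrassCurve.Affine.Point.map_injective _, fun Q' ↦
      ⟨WeierstrassCurve.Affine.Point.map (W' := W) (eL.symm : F' →ₐ[F] L) Q', ?_⟩⟩
    change WeierstrassCurve.Affine.Point.map _ (WeierstrassCurve.Affine.Point.map _ Q') = Q'
    rw [WeierstrassCurve.Affine.Point.map_map, AlgEquiv.comp_symm]
    cases Q' <;> rfl
  -- `m ∘ m₁ = map j`
  have hjval : (F'.val : F' →ₐ[F] AlgebraicClosure F).comp (eL : L →ₐ[F] F') = j := by
    ext x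
    exact AlgHom.equivFieldRange_apply_coe j x
  have hmm₁ : ∀ R : (W.baseChange L).toAffine.Point, m (m₁ R) = WeierstrassCurve.Affine.Point.map (W' := W) j R := by
    intro R
    change WeierstrassCurve.Affine.Point.map _ (WeierstrassCurve.Affine.Point.map _ R) = _
    rw [WeierstrassCurve.Affine.Point.map_map, hjval]
  -- `σ` acts on `j(E(L))` through `τ`
  have hστ : ∀ R : (W.baseChange L).toAffine.Point,
      σ • m (m₁ R) = m (m₁ (WeierstrassCurve.Affine.Point.map (W' := W) (τ : L →ₐ[F] L) R)) := by
    intro R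
    rw [hmm₁, hmm₁]
    change WeierstrassCurve.Affine.Point.map
      ((show AlgebraicClosure F ≃ₐ[F] AlgebraicClosure F from σ) : AlgebraicClosure F →ₐ[F] AlgebraicClosure F)
        (WeierstrassCurve.Affine.Point.map (W' := W) j R) = _
    rw [WeierstrassCurve.Affine.Point.map_map, WeierstrassCurve.Affine.Point.map_map, hj,
      algHom_comp_eq_comp_of_not_mem_galRange L h2 τ hτ hσN]
  -- the anti-invariant points `P_i = j(Q_i) ∈ S`
  set P : ι → geomPoints W := fun i ↦ m (m₁ (Q i)) with hPdef
  have hPS : ∀ i, P i ∈ S := fun i ↦ ⟨m₁ (Q i), rfl⟩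
  have hσP : ∀ i, σ • P i = -P i := fun i ↦ by
    simp only [hPdef, hστ, hQ, map_neg]
  -- §1
  obtain ⟨x, hx, hrel⟩ := exists_inflClass_family_of_smul_eq_neg hNopen hσ hS P hPS hσP
  refine ⟨x, fun i ↦ ?_, fun i ↦ ?_, fun c ↦ ?_⟩
  · -- `res_L x_i = 0`: inflated classes die on `Γ_L`
    obtain ⟨f, hf⟩ := hx i
    rw [mem_ker_resBaseChange_iff, ← hf]
    exact inflClass_mem_resKer_of_range_le (resGal (K := F) L) (pointsMap W L) (pointsMap_smul W L) hNopen
      (by rw [hNdef]; exact le_rfl) f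
  · -- `2 x_i = 0`
    obtain ⟨f, hf⟩ := hx i
    rw [← hf, ← hidx]
    exact index_nsmul_inflClass N hNopen f
  · -- relations
    rw [hrel c]
    have hsum : ∑ i, c i • P i = m (m₁ (∑ i, c i • Q i)) := by
      simp only [hPdef, map_sum, map_zsmul]
    constructor
    · rintro ⟨b, ⟨B, rfl⟩, hb⟩
      obtain ⟨R, rfl⟩ := hm₁.2 B
      refine ⟨R, ?_⟩
      apply hm₁.1
      apply hminj
      rw [← hsum, hb, map_sub, map_sub, hστ]
    · rintro ⟨R, hR⟩
      refine ⟨m (m₁ R), ⟨m₁ R, rfl⟩, ?_⟩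
      rw [hsum, hR, map_sub, map_sub, hστ]

/-- **Independent genus classes from points independent modulo `(τ − 1)E(L)`.**  In the situation of `exists_genusClasses`, if
`Σ c_i Q_i ∈ (τ−1)E(L)` forces `2 ∣ c_i` for all `i`, then the genus classes `x_i` are non-zero of order exactly `2`, die over `L`,
and are `𝔽₂`-independent — the exact datum (`hx`, `hxo`, `hxi`) of `…RTGenusLadder.not_jointGenusCount_of_kerPairs` (there with
`ι = Fin 2` on each of `W`, `Wd`). [cite: Kramer1981, §3 (proof of Thm. 2) and §5 Prop. 8] [cite: SerreLocalFields1979, VIII.§4] -/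
theorem exists_genusClasses_of_indep (h2 : Module.finrank F L = 2) (τ : L ≃ₐ[F] L) (hτ : τ ≠ 1)
    {ι : Type*} [Fintype ι] [DecidableEq ι] (Q : ι → (W.baseChange L).toAffine.Point)
    (hQ : ∀ i, WeierstrassCurve.Affine.Point.map (W' := W) (τ : L →ₐ[F] L) (Q i) = -Q i)
    (hind : ∀ c : ι → ℤ, (∃ R : (W.baseChange L).toAffine.Point,
      ∑ i, c i • Q i = WeierstrassCurve.Affine.Point.map (W' := W) (τ : L →ₐ[F] L) R - R) → ∀ i, (2 : ℤ) ∣ c i) :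
    ∃ x : ι → W.galH1, (∀ i, resBaseChange W L (x i) = 0) ∧ (∀ i, addOrderOf (x i) = 2) ∧
      ∀ c : ι → ℤ, ∑ i, c i • x i = 0 → ∀ i, (2 : ℤ) ∣ c i := by
  obtain ⟨x, hres, h2x, hrel⟩ := exists_genusClasses W L h2 τ hτ Q hQ
  have hind' : ∀ c : ι → ℤ, ∑ i, c i • x i = 0 → ∀ i, (2 : ℤ) ∣ c i := fun c hc ↦ hind c ((hrel c).mp hc)
  refine ⟨x, hres, fun i ↦ ?_, hind'⟩
  haveI : Fact (Nat.Prime 2) := ⟨Nat.prime_two⟩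
  refine addOrderOf_eq_prime (h2x i) fun hxi ↦ ?_
  -- `x_i = 0` would give the relation `1 • x_i = 0` with an odd coefficient
  have h := hind' (fun k ↦ if k = i then 1 else 0) (by
    simp only [ite_smul, one_smul, zero_smul, Finset.sum_ite_eq', Finset.mem_univ, if_true, hxi]) i
  simp only [if_true] at h
  omega

end Field

end Summit.BirchSwinnertonDyer.BirchSwinnertonDyer.Theorems.GenusExact.PlusDescent

end
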